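import Summits.HodgeConjecture.HodgeConjecture.Theorems.K2E1bU21HighestWeightSpaces   -- ★ αᵤ-1∕1b `wtSpace`, `hwSpace`, `labelN`, `u21e_eq`, `u21f_eq`, weight shifts
import Summits.HodgeConjecture.HodgeConjecture.Theorems.K2E1bU21KTypeStrings          -- ★ αᵤ-2a the `𝔰𝔩₂`-string formulas `u21h∕u21e_apply_u21f_pow_(succ_)apply`
import Literature.RepresentationTheory.BorelWallach2000.TrivialModuleGKCohomologyUnitary -- ★ `upq_mem_kInLie_iff_blocks`, `upq_lie_blocks`
import HarnessLib

/-!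
# K2 ∕ E1b — αᵤ road row 2c, part 1 «THE `𝔨`-STRING SPAN OF A HIGHEST-WEIGHT VECTOR» (`U(2,1)`)

Cell hodgecm-mathlib, Track B «K2-LIT», engine E1b, unit U8; crux item h413 = stmt-HodgeConjecture-24833 (supports-only helper; closes nothing by itself).
Row αᵤ-2c of K2E1b-plan (g4) (DEALT 2026-09-04T04:16:02Z (M2) ∕ 04:17:23Z to the desk K2-defs1 (g3)); this is the definition-free algebra half, split off
the head file `Theorems/K2E1bU21HwLineMultiplicityOne.lean` for the 400-line lint.  THEOREMS ONLY — no `def`, no `sorry`, no axiom, no instance declaration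
(one `attribute [local instance] LieRing.ofAssociativeRing`), no notation.

## Contents

§1 `𝔨 = 𝔲(2) ⊕ 𝔲(1) ⊂ 𝔲(2,1)` THROUGH THE FIVE BLOCK-DIAGONAL UNITS `E₀₀, E₀₁, E₁₀, E₁₁, E₂₂`: for `Y ∈ 𝔨` (★ `RealMatrixGroup.kInLie`) the mixed entries
vanish (★ `upq_mem_kInLie_iff_blocks`, ★ `upq_lie_blocks`) and `ρ(Y) = Σ_{a,b<2} Y_ab ρ_ℂ(E_ab) + Y_22 ρ_ℂ(E_22)` (★ `upqLieC_coe`); hence a subspace stable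
under the five `ρ_ℂ(E_ij)` is `𝔨`-stable (`kInLie_apply_mem_of_units`, `compactLie_apply_mem_of_units` — the hypothesis shape of ★ αᵤ-5a′
`IsGKModule.ρK_apply_mem_of_lieStable`) and a linear map commuting with the five units on `U` commutes with `ρ(𝔨)` on `U` (`map_compactLie_apply_of_units` —
the hypothesis shape of ★ `IsGKModule.map_ρK_of_lie_comm_on`).
§2 THE STRING SPAN `S = ⟨g, fg, …, f^m g⟩` of a primitive `g ∈ hwSpace w` (`e g = 0`) with `n − 1 = m` (`n = labelN w`, so `h g = m g`) and `f^{m+1} g = 0`: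
torus weights along the string (`u21f_pow_apply_mem_wtSpace`), stability under the five units (`string_units_stable`, `string_unit₂₂_stable`), linear
independence when no `f^k g` vanishes (`linearIndependent_string`: distinct `h`-weights `m − 2k`), `ker e ∩ S = ℂ g` (`exists_eq_smul_of_u21e_eq_zero`:
`e f^{k+1} g = (k+1)(m−k) f^k g` with `(k+1)(m−k) ≠ 0` for `k < m`), and `e^{m+1} = 0` on `S` (`u21e_pow_apply_eq_zero`).

Sources: [Kovacevic2021, §3 Def. 1 (the adapted basis `v^k_{nm}` of a K-type), Remark 1]; [KnappVogan1995, §IV.1 (𝔰𝔩₂-strings)]; [BorelWallach2000, II §1.1 (3)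
(`𝔨` block diagonal)].

HONEST LABEL: kernel theorems about abstract `(𝔤, K)`-module data of `U(2,1)`; a helper of the 8b-αᵤ road, it closes no socket by itself.  HC_CM is proved
only modulo the 7 printed citations (2 remaining named inputs: hLiu418 = stmt-HodgeConjecture-24832, h413 = stmt-HodgeConjecture-24833) until rung 0 closes.
-/

-- Mathlib idiom (as in ★ `GKModules` and every `(𝔤, K)` file of the tree): the commutator bracket on `Module.End ℂ V` ∕ matrices, needed to MENTION
-- `ρ𝔤 : G21.lie →ₗ⁅ℝ⁆ Module.End ℂ V` (`LieRing.ofAssociativeRing` is a `def` in Mathlib).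
attribute [local instance 100] LieRing.ofAssociativeRing

set_option autoImplicit false
set_option linter.dupNamespace false

noncomputable section

open Module
open Literature.RepresentationTheory Literature.RepresentationTheory.BorelWallach2000
open Literature.RepresentationTheory.KonnoKonno2007 Literature.RepresentationTheory.KonnoKonno2007.RealDualPair
open Literature.NumberTheory.Automorphic
open Summit.HodgeConjecture.HodgeConjecture.Cruxes.H413.F0P3bLocalAPacketsDefs (G21)
open Summit.HodgeConjecture.HodgeConjecture.Cruxes.H413.K2E1bU21Weights
open Summit.HodgeConjecture.HodgeConjecture.Cruxes.H413.K2E1bU21KTypeStrings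

namespace Summit.HodgeConjecture.HodgeConjecture.Cruxes.H413.K2E1bU21HwLines

variable {V : Type*} [AddCommGroup V] [Module ℂ V]
  {ρK : Representation ℂ G21.maximalCompact V} (ρ𝔤 : G21.lie →ₗ⁅ℝ⁆ Module.End ℂ V)

/-! ## §1 `𝔨 = 𝔲(2) ⊕ 𝔲(1)` through the five block-diagonal matrix units -/

/-- The off-diagonal blocks of `Y ∈ 𝔨 ⊂ 𝔲(2,1)` vanish: `Y_{a,2} = 0 = Y_{2,a}` (`a = 0, 1`). [cite: BorelWallach2000, II §1.1 (3)] -/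
theorem apply_inl_inr_eq_zero_of_mem_kInLie {Y : G21.lie} (hY : Y ∈ G21.kInLie) (a : Fin 2) (c : Fin 1) :
    (Y : Matrix (Fin 2 ⊕ Fin 1) (Fin 2 ⊕ Fin 1) ℂ) (Sum.inl a) (Sum.inr c) = 0 ∧
      (Y : Matrix (Fin 2 ⊕ Fin 1) (Fin 2 ⊕ Fin 1) ℂ) (Sum.inr c) (Sum.inl a) = 0 := by
  have h12 := (upq_mem_kInLie_iff_blocks Y).1 hY
  have h21 : (Y : Matrix (Fin 2 ⊕ Fin 1) (Fin 2 ⊕ Fin 1) ℂ).toBlocks₂₁ = 0 := by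
    rw [(upq_lie_blocks Y).2.2, h12, Matrix.conjTranspose_zero]
  refine ⟨?_, ?_⟩
  · have h := congrFun (congrFun h12 a) c
    rwa [Matrix.toBlocks₁₂, Matrix.of_apply, Matrix.zero_apply] at h
  · have h := congrFun (congrFun h21 c) a
    rwa [Matrix.toBlocks₂₁, Matrix.of_apply, Matrix.zero_apply] at h

/-- **`ρ(Y)` for `Y ∈ 𝔨` is the combination of the five block-diagonal units**:
`ρ(Y) u = Σ_{a,b<2} Y_{ab} ρ_ℂ(E_{ab}) u + Y_{22} ρ_ℂ(E_{22}) u`. [cite: BorelWallach2000, II §1.1 (3)] -/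
theorem apply_eq_sum_units_of_mem_kInLie {Y : G21.lie} (hY : Y ∈ G21.kInLie) (u : V) :
    ρ𝔤 Y u = (∑ a : Fin 2, ∑ b : Fin 2, (Y : Matrix (Fin 2 ⊕ Fin 1) (Fin 2 ⊕ Fin 1) ℂ) (Sum.inl a) (Sum.inl b) •
        upqLieC ρ𝔤 (Matrix.single (Sum.inl a) (Sum.inl b) (1 : ℂ)) u) +
      (Y : Matrix (Fin 2 ⊕ Fin 1) (Fin 2 ⊕ Fin 1) ℂ) (Sum.inr 0) (Sum.inr 0) • upqLieC ρ𝔤 (Matrix.single (Sum.inr 0) (Sum.inr 0) (1 : ℂ)) u := by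
  have h0 := fun a => apply_inl_inr_eq_zero_of_mem_kInLie hY a 0
  -- `Y = Σ_{a,b} Y_ab E_ab + Y_22 E_22` as matrices (the mixed entries vanish)
  have hsum : (Y : Matrix (Fin 2 ⊕ Fin 1) (Fin 2 ⊕ Fin 1) ℂ) =
      (∑ a : Fin 2, ∑ b : Fin 2, (Y : Matrix (Fin 2 ⊕ Fin 1) (Fin 2 ⊕ Fin 1) ℂ) (Sum.inl a) (Sum.inl b) •
        Matrix.single (Sum.inl a) (Sum.inl b) (1 : ℂ)) +
      (Y : Matrix (Fin 2 ⊕ Fin 1) (Fin 2 ⊕ Fin 1) ℂ) (Sum.inr 0) (Sum.inr 0) • Matrix.single (Sum.inr 0) (Sum.inr 0) (1 : ℂ) := by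
    ext i j
    rcases i with a | c <;> rcases j with b | d
    · fin_cases a <;> fin_cases b <;> simp [Fin.sum_univ_two]
    · fin_cases d
      fin_cases a <;> simp [Fin.sum_univ_two, (h0 _).1]
    · fin_cases c
      fin_cases b <;> simp [Fin.sum_univ_two, (h0 _).2]
    · fin_cases c; fin_cases d
      simp [Fin.sum_univ_two]
  conv_lhs => rw [← upqLieC_coe ρ𝔤 Y, hsum]
  simp only [map_add, map_sum, map_smul, LinearMap.add_apply, LinearMap.sum_apply, LinearMap.smul_apply]

/-- **A subspace stable under the five block-diagonal units is `𝔨`-stable** (`𝔨 ⊂` their complex span). [cite: BorelWallach2000, II §1.1 (3)] -/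
theorem kInLie_apply_mem_of_units {U : Submodule ℂ V}
    (h₁ : ∀ (a b : Fin 2), ∀ u ∈ U, upqLieC ρ𝔤 (Matrix.single (Sum.inl a) (Sum.inl b) (1 : ℂ)) u ∈ U)
    (h₂ : ∀ u ∈ U, upqLieC ρ𝔤 (Matrix.single (Sum.inr 0) (Sum.inr 0) (1 : ℂ)) u ∈ U) :
    ∀ Y ∈ G21.kInLie, ∀ u ∈ U, ρ𝔤 Y u ∈ U := by
  intro Y hY u hu
  rw [apply_eq_sum_units_of_mem_kInLie ρ𝔤 hY u]
  refine U.add_mem (U.sum_mem fun a _ => U.sum_mem fun b _ => U.smul_mem _ (h₁ a b u hu)) (U.smul_mem _ (h₂ u hu))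

/-- The same for `Y : 𝔨` through the inclusion `𝔨 ↪ 𝔤` (the form ★ `IsGKModule.ρK_apply_mem_of_lieStable` consumes). [cite: BorelWallach2000, II §1.1 (3)] -/
theorem compactLie_apply_mem_of_units {U : Submodule ℂ V}
    (h₁ : ∀ (a b : Fin 2), ∀ u ∈ U, upqLieC ρ𝔤 (Matrix.single (Sum.inl a) (Sum.inl b) (1 : ℂ)) u ∈ U)
    (h₂ : ∀ u ∈ U, upqLieC ρ𝔤 (Matrix.single (Sum.inr 0) (Sum.inr 0) (1 : ℂ)) u ∈ U) :
    ∀ (Y : G21.compactLie) (u : V), u ∈ U → ρ𝔤 (LieSubalgebra.inclusion G21.compactLie_le_lie Y) u ∈ U :=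
  fun Y u hu => kInLie_apply_mem_of_units ρ𝔤 h₁ h₂ _ ⟨Y, rfl⟩ u hu

/-- **A linear map commuting with the five block-diagonal units on `U` commutes with `ρ(𝔨)` on `U`.** [cite: BorelWallach2000, II §1.1 (3)] -/
theorem map_compactLie_apply_of_units {V' : Type*} [AddCommGroup V'] [Module ℂ V'] (ρ𝔤' : G21.lie →ₗ⁅ℝ⁆ Module.End ℂ V')
    {U : Submodule ℂ V} (Φ : V →ₗ[ℂ] V')
    (h₁ : ∀ (a b : Fin 2), ∀ u ∈ U, Φ (upqLieC ρ𝔤 (Matrix.single (Sum.inl a) (Sum.inl b) (1 : ℂ)) u) =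
      upqLieC ρ𝔤' (Matrix.single (Sum.inl a) (Sum.inl b) (1 : ℂ)) (Φ u))
    (h₂ : ∀ u ∈ U, Φ (upqLieC ρ𝔤 (Matrix.single (Sum.inr 0) (Sum.inr 0) (1 : ℂ)) u) =
      upqLieC ρ𝔤' (Matrix.single (Sum.inr 0) (Sum.inr 0) (1 : ℂ)) (Φ u)) :
    ∀ (Y : G21.compactLie) (u : V), u ∈ U →
      Φ (ρ𝔤 (LieSubalgebra.inclusion G21.compactLie_le_lie Y) u) = ρ𝔤' (LieSubalgebra.inclusion G21.compactLie_le_lie Y) (Φ u) := by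
  intro Y u hu
  have hY : LieSubalgebra.inclusion G21.compactLie_le_lie Y ∈ G21.kInLie := ⟨Y, rfl⟩
  rw [apply_eq_sum_units_of_mem_kInLie ρ𝔤 hY u, apply_eq_sum_units_of_mem_kInLie ρ𝔤' hY (Φ u)]
  simp only [map_add, map_sum, map_smul, h₁ _ _ u hu, h₂ u hu]

/-! ## §2 The `𝔨`-string `g, fg, …, f^m g` of a primitive vector: weights, unit-stability, independence, `ker e`, nilpotency of `e` -/

/-- A span `span (range v)` is stable under a linear map that sends every `v i` into it. [folklore] -/
theorem span_range_stable {ι : Type*} (v : ι → V) (T : V →ₗ[ℂ] V) (h : ∀ i, T (v i) ∈ Submodule.span ℂ (Set.range v)) :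
    ∀ u ∈ Submodule.span ℂ (Set.range v), T u ∈ Submodule.span ℂ (Set.range v) := fun _ hu =>
  (Submodule.span_le (p := (Submodule.span ℂ (Set.range v)).comap T)).mpr (Set.range_subset_iff.mpr h) hu

/-- **`f^k V[w] ⊆ V[w + k(δ₁ − δ₀)]`**: the torus weights along an `f`-string. [cite: Kovacevic2021, §3 Def. 1] -/
theorem u21f_pow_apply_mem_wtSpace {w : Fin 2 ⊕ Fin 1 → ℤ} {v : V} (hv : v ∈ wtSpace ρ𝔤 w) (k : ℕ) :
    (u21f ρ𝔤 ^ k) v ∈ wtSpace ρ𝔤 (w + k • (Pi.single (Sum.inl 1) 1 - Pi.single (Sum.inl 0) 1)) := by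
  induction k with
  | zero => simpa only [pow_zero, Module.End.one_apply, zero_smul, add_zero] using hv
  | succ k ih =>
    have h := u21f_apply_mem_wtSpace ρ𝔤 ih
    rw [pow_succ', Module.End.mul_apply]
    convert h using 2
    rw [succ_nsmul]
    abel

/-- **`h v = m v` on `V[w]` when `n − 1 = m`** (★ `u21h_apply_of_mem_wtSpace'` with the label read as a natural number). [cite: Kovacevic2021, §3 Def. 1] -/
theorem u21h_apply_eq_natCast_smul {w : Fin 2 ⊕ Fin 1 → ℤ} {m : ℕ} (hm : ((labelN w - 1 : ℤ) : ℂ) = m) {v : V} (hv : v ∈ wtSpace ρ𝔤 w) :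
    u21h ρ𝔤 v = (m : ℂ) • v := by
  rw [u21h_apply_of_mem_wtSpace' ρ𝔤 hv, hm]

section String

variable {w : Fin 2 ⊕ Fin 1 → ℤ} {g : V} {m : ℕ}

/-- **The string span `⟨g, fg, …, f^m g⟩` of a primitive `g` (`e g = 0`, `h g = m g`, `f^{m+1} g = 0`) is stable under the four units of `𝔤𝔩₂ ⊂ 𝔨_ℂ`**
(`E₀₀`, `E₁₁` by weights, `E₀₁ = e` by the string formula, `E₁₀ = f` by construction). [cite: Kovacevic2021, §3 Def. 1] [cite: KnappVogan1995, §IV.1] -/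
theorem string_units_stable (hg : g ∈ hwSpace ρ𝔤 w) (hm : ((labelN w - 1 : ℤ) : ℂ) = m) (htop : (u21f ρ𝔤 ^ (m + 1)) g = 0) (a b : Fin 2) :
    ∀ u ∈ Submodule.span ℂ (Set.range fun i : Fin (m + 1) => (u21f ρ𝔤 ^ (i : ℕ)) g),
      upqLieC ρ𝔤 (Matrix.single (Sum.inl a) (Sum.inl b) (1 : ℂ)) u ∈ Submodule.span ℂ (Set.range fun i : Fin (m + 1) => (u21f ρ𝔤 ^ (i : ℕ)) g) := by
  rw [mem_hwSpace_iff] at hg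
  refine span_range_stable _ _ fun i => ?_
  have hwt := u21f_pow_apply_mem_wtSpace ρ𝔤 hg.1 (i : ℕ)
  by_cases hab : a = b
  · -- `E₀₀`, `E₁₁`: weights
    subst hab
    rw [(mem_wtSpace_iff ρ𝔤 _ _).1 hwt (Sum.inl a)]
    exact Submodule.smul_mem _ _ (Submodule.subset_span ⟨i, rfl⟩)
  have key : ∀ a b : Fin 2, a ≠ b → (a = 0 ∧ b = 1) ∨ (a = 1 ∧ b = 0) := by decide
  obtain ⟨rfl, rfl⟩ | ⟨rfl, rfl⟩ := key a b hab
  · -- `E₀₁ = e`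
    rw [← u21e_eq]
    rcases i with ⟨_ | k, hk⟩
    · rw [pow_zero, Module.End.one_apply, hg.2]; exact zero_mem _
    · change u21e ρ𝔤 ((u21f ρ𝔤 ^ (k + 1)) g) ∈ _
      rw [u21e_apply_u21f_pow_succ_apply ρ𝔤 (u21h_apply_eq_natCast_smul ρ𝔤 hm hg.1) hg.2 k]
      exact Submodule.smul_mem _ _ (Submodule.subset_span ⟨⟨k, by omega⟩, rfl⟩)
  · -- `E₁₀ = f`
    rw [← u21f_eq, ← Module.End.mul_apply, ← pow_succ']
    by_cases hi : (i : ℕ) + 1 ≤ m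
    · exact Submodule.subset_span ⟨⟨(i : ℕ) + 1, by omega⟩, rfl⟩
    · have : (i : ℕ) + 1 = m + 1 := by omega
      rw [this, htop]; exact zero_mem _

/-- The string span is stable under `E₂₂` (a weight). [cite: Kovacevic2021, §3 Def. 1] -/
theorem string_unit₂₂_stable (hg : g ∈ hwSpace ρ𝔤 w) :
    ∀ u ∈ Submodule.span ℂ (Set.range fun i : Fin (m + 1) => (u21f ρ𝔤 ^ (i : ℕ)) g),
      upqLieC ρ𝔤 (Matrix.single (Sum.inr 0) (Sum.inr 0) (1 : ℂ)) u ∈ Submodule.span ℂ (Set.range fun i : Fin (m + 1) => (u21f ρ𝔤 ^ (i : ℕ)) g) := by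
  rw [mem_hwSpace_iff] at hg
  refine span_range_stable _ _ fun i => ?_
  rw [(mem_wtSpace_iff ρ𝔤 _ _).1 (u21f_pow_apply_mem_wtSpace ρ𝔤 hg.1 (i : ℕ)) (Sum.inr 0)]
  exact Submodule.smul_mem _ _ (Submodule.subset_span ⟨i, rfl⟩)

/-- **`g, fg, …, f^m g` are linearly independent** when none vanishes: `h`-eigenvectors of the distinct weights `m − 2k`. [cite: KnappVogan1995, §IV.1] -/
theorem linearIndependent_string (hm : u21h ρ𝔤 g = (m : ℂ) • g) (hne : ∀ k ≤ m, (u21f ρ𝔤 ^ k) g ≠ 0) :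
    LinearIndependent ℂ fun i : Fin (m + 1) => (u21f ρ𝔤 ^ (i : ℕ)) g := by
  refine Module.End.eigenvectors_linearIndependent' (u21h ρ𝔤) (fun i : Fin (m + 1) => (m : ℂ) - 2 * (i : ℕ)) ?_ _ fun i => ?_
  · intro i j hij
    have h2 : (2 : ℂ) * (i : ℕ) = 2 * (j : ℕ) := sub_right_inj.mp hij
    exact Fin.ext (Nat.cast_injective (R := ℂ) (mul_left_cancel₀ two_ne_zero h2))
  · exact ⟨Module.End.mem_eigenspace_iff.mpr (u21h_apply_u21f_pow_apply ρ𝔤 hm i), hne i (by omega)⟩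

/-- **`ker e` on the string span is the line `ℂ g`**: `e (Σ c_k f^k g) = Σ_{k ≥ 1} c_k k(m − k + 1) f^{k−1} g` and `k(m − k + 1) ≠ 0` for `1 ≤ k ≤ m`.
[cite: KnappVogan1995, §IV.1] -/
theorem exists_eq_smul_of_u21e_eq_zero (hg : g ∈ hwSpace ρ𝔤 w) (hm : ((labelN w - 1 : ℤ) : ℂ) = m) (hne : ∀ k ≤ m, (u21f ρ𝔤 ^ k) g ≠ 0)
    {x : V} (hx : x ∈ Submodule.span ℂ (Set.range fun i : Fin (m + 1) => (u21f ρ𝔤 ^ (i : ℕ)) g)) (hex : u21e ρ𝔤 x = 0) :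
    ∃ c : ℂ, x = c • g := by
  rw [mem_hwSpace_iff] at hg
  have hμ := u21h_apply_eq_natCast_smul ρ𝔤 hm hg.1
  obtain ⟨c, rfl⟩ := (Submodule.mem_span_range_iff_exists_fun ℂ).mp hx
  -- `e x = Σ_{k<m} (c_{k+1} (k+1)(m−k)) • f^k g`
  have hex' : ∑ i : Fin m, (c i.succ * ((i : ℕ) + 1) * ((m : ℂ) - (i : ℕ))) • (u21f ρ𝔤 ^ (i : ℕ)) g = 0 := by
    rw [map_sum, Fin.sum_univ_succ] at hex
    simp only [map_smul, Fin.val_zero, pow_zero, Module.End.one_apply, hg.2, smul_zero, zero_add, Fin.val_succ,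
      u21e_apply_u21f_pow_succ_apply ρ𝔤 hμ hg.2, smul_smul] at hex
    simpa only [mul_assoc] using hex
  -- independence of `f^k g`, `k < m`
  have hli := (linearIndependent_string ρ𝔤 hμ hne).comp Fin.castSucc (Fin.castSucc_injective m)
  have hc : ∀ i : Fin m, c i.succ = 0 := by
    intro i
    have h := Fintype.linearIndependent_iff.mp hli (fun i : Fin m => c i.succ * ((i : ℕ) + 1) * ((m : ℂ) - (i : ℕ))) (by
      simpa only [Function.comp_def, Fin.val_castSucc] using hex') i
    have h1 : ((i : ℕ) + 1 : ℂ) ≠ 0 := Nat.cast_add_one_ne_zero _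
    have h2 : ((m : ℂ) - (i : ℕ)) ≠ 0 := sub_ne_zero.mpr (fun h => (Nat.cast_injective (R := ℂ) h ▸ i.2 : (i : ℕ) < (i : ℕ)).false)
    simpa [h1, h2] using h
  refine ⟨c 0, ?_⟩
  rw [Fin.sum_univ_succ]
  simp only [hc, zero_smul, Finset.sum_const_zero, add_zero, Fin.val_zero, pow_zero, Module.End.one_apply]

/-- `e^{k+1} (f^k g) = 0` for a primitive `g`. [cite: KnappVogan1995, §IV.1] -/
theorem u21e_pow_succ_apply_u21f_pow_apply (hg : g ∈ hwSpace ρ𝔤 w) (hm : ((labelN w - 1 : ℤ) : ℂ) = m) (k : ℕ) :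
    (u21e ρ𝔤 ^ (k + 1)) ((u21f ρ𝔤 ^ k) g) = 0 := by
  rw [mem_hwSpace_iff] at hg
  have hμ := u21h_apply_eq_natCast_smul ρ𝔤 hm hg.1
  induction k with
  | zero => rw [zero_add, pow_one, pow_zero, Module.End.one_apply, hg.2]
  | succ k ih => rw [pow_succ, Module.End.mul_apply, u21e_apply_u21f_pow_succ_apply ρ𝔤 hμ hg.2 k, map_smul, ih, smul_zero]

/-- **`e` is nilpotent on the string span**: `e^{m+1} = 0` there. [cite: KnappVogan1995, §IV.1] -/
theorem u21e_pow_apply_eq_zero (hg : g ∈ hwSpace ρ𝔤 w) (hm : ((labelN w - 1 : ℤ) : ℂ) = m)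
    {x : V} (hx : x ∈ Submodule.span ℂ (Set.range fun i : Fin (m + 1) => (u21f ρ𝔤 ^ (i : ℕ)) g)) :
    (u21e ρ𝔤 ^ (m + 1)) x = 0 := by
  have hle : Submodule.span ℂ (Set.range fun i : Fin (m + 1) => (u21f ρ𝔤 ^ (i : ℕ)) g) ≤ LinearMap.ker (u21e ρ𝔤 ^ (m + 1)) := by
    refine Submodule.span_le.mpr (Set.range_subset_iff.mpr fun i => LinearMap.mem_ker.mpr ?_)
    have hsplit : u21e ρ𝔤 ^ (m + 1) = u21e ρ𝔤 ^ (m - (i : ℕ)) * u21e ρ𝔤 ^ ((i : ℕ) + 1) := by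
      rw [← pow_add]; congr 1; omega
    rw [hsplit, Module.End.mul_apply, u21e_pow_succ_apply_u21f_pow_apply ρ𝔤 hg hm, map_zero]
  exact LinearMap.mem_ker.mp (hle hx)

end String

end Summit.HodgeConjecture.HodgeConjecture.Cruxes.H413.K2E1bU21HwLines

end
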